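import Summits.FinalStateConjecture.FinalStateConjecture.Theorems.SwallowTheDatumKerrShieldedSettlesStubKerrExteriorDecompositionLateCharts
import Summits.FinalStateConjecture.FinalStateConjecture.Theorems.SwallowTheDatumKerrShieldedSettlesStubCollarEmbedsMGHDAux
import Literature.Geometry.Lorentzian.CausalityConditionsProofs
import Literature.Geometry.Lorentzian.CausalityPushUp
import HarnessLib

/-!
# `KerrShieldedSettles`, line `tapered-temporal-collar` — stub S6a, part E: the covering case analysis

Chart preimages of explicit points (`(t, x⃗)` is the hole-chart or flat-chart image of `(s, x⃗)` when its
time coordinate is the corresponding chart time) and the causal covering clauses of the decomposition, given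
the helix connector of stub S6c (as an ∃-hypothesis): `covering_certified` (clause (ii) of
`HasExhaustiveCharts` at `τ₁ > τ₀`, Disproof §F re-derived: `s := x⁰ − c₀`, `f := s − T(r)`; `s ≤ τ₁`:
hole truncated slab if `r ≤ R(τ₁)`, flat slab otherwise; `s > τ₁`: then `r > R(s) ≥ R(τ₁) > √τ₁ ≥ √f`,
so flat non-membership forces `f ≤ τ₁`), `covering_initial` (`diff_subset_causalPast` at `τ₀` through the
full hole slab, by surjectivity of the chart time), `mem_chronologicalPast_holeLate` (`O_K ⊆ I⁻(charted)`);
plus time-dual membership lemmas (`J⁺`/`I⁺` witness ⇒ `J⁻`/`I⁻` membership).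
References: Dafermos–Luk arXiv:1710.01722 Conjecture 1; DHRT arXiv:2104.08222 §1; O'Neill 1983 Ch. 14.
-/

set_option linter.dupNamespace false

noncomputable section

open Set Filter Topology
open scoped Manifold ContDiff Topology ENNReal
open Literature.Geometry.Lorentzian
open Summit.FinalStateConjecture.FinalStateConjecture.Theorems.KerrShieldedDataExist.Negative
  (bentHeight contDiff_bentHeight)

namespace Summit.FinalStateConjecture.FinalStateConjecture.Theorems.SwallowTheDatum.KerrShieldedSettles

namespace ExteriorDecomposition

/-! ## Generic causal bookkeeping -/

section Causal

variable {E : Type*} [NormedAddCommGroup E] [NormedSpace ℝ E] {H : Type*} [TopologicalSpace H]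
  {I : ModelWithCorners ℝ E H} {n : WithTop ℕ∞} {N : Type*} [TopologicalSpace N] [ChartedSpace H N]
  [IsManifold I ∞ N] {g : LorentzianMetric I n N} {τ : TimeOrientation g}

/-- If `x'` lies in the causal future of `x` and in `S`, then `x` lies in the causal past of `S`
(read the connecting causal curve backwards). [cite: ONeillSemiRiemannian1983, Ch. 14, p. 402] -/
theorem mem_causalPast_of_mem_causalFuture_singleton {x x' : N} {S : Set N}
    (h : x' ∈ g.causalFuture τ {x}) (hS : x' ∈ S) : x ∈ g.causalPast τ S := by
  rcases h with hx' | ⟨p, hp, γ, a', b', hab, hγ, hγa, hγb⟩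
  · rw [mem_singleton_iff] at hx'
    subst hx'
    exact LorentzianMetric.subset_causalPast g τ S hS
  · rw [mem_singleton_iff] at hp
    subst hp
    refine Or.inr ⟨x', hS, fun t ↦ γ (a' + b' - t), a', b', hab,
      LorentzianMetric.IsFutureCausalCurveOn.reverseParam hγ, ?_, ?_⟩
    · simp [hγb]
    · simp [hγa]

/-- If `x'` lies in the chronological future of `x` and in `S`, then `x` lies in the chronological
past of `S`. [cite: ONeillSemiRiemannian1983, Ch. 14, p. 402] -/
theorem mem_chronologicalPast_of_mem_chronologicalFuture_singleton {x x' : N} {S : Set N}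
    (h : x' ∈ g.chronologicalFuture τ {x}) (hS : x' ∈ S) : x ∈ g.chronologicalPast τ S :=
  LorentzianMetric.chronologicalFuture_mono (singleton_subset_iff.2 hS)
    (LorentzianMetric.mem_chronologicalPast_of_mem_chronologicalFuture h)

end Causal

/-- Two points of `E4` with the same time coordinate and the same spatial part coincide. [folklore] -/
theorem E4_eq_of_time_spatial {u v : E4} (h0 : u 0 = v 0) (hs : E4.spatial u = E4.spatial v) : u = v := by
  rw [← E4.ofTimeSpace_time_spatial u, ← E4.ofTimeSpace_time_spatial v, hs]
  exact congrArg (fun t ↦ E4.ofTimeSpace t (E4.spatial v)) h0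

/-! ## Chart preimages of explicit points -/

section Points

variable {M a r₁ τ₀ : ℝ}

/-- The point `(t, x⃗)` lies in the exterior when `r(x) > r₊ > 0`. [folklore] -/
theorem ofTimeSpace_spatial_mem_exterior (h0 : 0 < Kerr.rPlus M a) {x : E4}
    (hx : Kerr.rPlus M a < Kerr.radius a x) (t : ℝ) :
    E4.ofTimeSpace t (E4.spatial x) ∈ Kerr.exterior M a := by
  rw [Kerr.mem_exterior, CollarEmbedsMGHD.radius_ofTimeSpace_spatial]
  exact max_lt hx (h0.trans hx)

/-- **Hole-chart preimage.** A chart point `x` with `r(x) > r₊` whose time coordinate is the hole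
chart time `F(s, r x)` is the hole-chart image of `(s, x⃗)`. [folklore] -/
theorem eq_holeChart_ofTimeSpace (h : r₁ ≤ Kerr.rPlus M a) (h0 : 0 < Kerr.rPlus M a)
    {x : Kerr.region a r₁} (hx : Kerr.rPlus M a < Kerr.radius a (x : E4)) {s : ℝ}
    (ht : (x : E4) 0 = holeTime M a τ₀ (M + 3) s (Kerr.radius a (x : E4))) :
    holeChart M a r₁ τ₀ h ⟨E4.ofTimeSpace s (E4.spatial (x : E4)), ofTimeSpace_spatial_mem_exterior h0 hx s⟩
      = x := by
  apply Subtype.ext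
  rw [holeChart_coe]
  refine E4_eq_of_time_spatial ?_ ?_
  · rw [holeMap_apply_zero, E4.ofTimeSpace_apply_zero, CollarEmbedsMGHD.radius_ofTimeSpace_spatial, ht]
  · rw [spatial_holeMap, E4.spatial_ofTimeSpace]

/-- **Flat-chart preimage.** A chart point `x` with time coordinate `f + c₀ + T(r x)` and
`(f, x⃗) ∈ U₀` is the flat-chart image of `(f, x⃗)`. [folklore] -/
theorem eq_flatChart_ofTimeSpace (hτ : Kerr.rPlus M a ≤ Real.sqrt τ₀) (h : r₁ ≤ Kerr.rPlus M a)
    (h0 : 0 < Kerr.rPlus M a) {x : Kerr.region a r₁} {f : ℝ}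
    (hf : E4.ofTimeSpace f (E4.spatial (x : E4)) ∈ flatDomain a τ₀)
    (ht : (x : E4) 0 = f + (M + 3) + bentHeight M a (Kerr.radius a (x : E4))) :
    flatChart M a r₁ τ₀ hτ h h0 ⟨E4.ofTimeSpace f (E4.spatial (x : E4)), hf⟩ = x := by
  apply Subtype.ext
  rw [flatChart_coe]
  refine E4_eq_of_time_spatial ?_ ?_
  · rw [flatMap_apply_zero, E4.ofTimeSpace_apply_zero, CollarEmbedsMGHD.radius_ofTimeSpace_spatial, ht]
  · rw [spatial_flatMap, E4.spatial_ofTimeSpace]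

/-- Membership of `(f, x⃗)` in the flat domain. [folklore] -/
theorem ofTimeSpace_spatial_mem_flatDomain {x : E4} {f : ℝ} (hf : τ₀ < f)
    (hr : Real.sqrt f < Kerr.radius a x) : E4.ofTimeSpace f (E4.spatial x) ∈ flatDomain a τ₀ := by
  rw [mem_flatDomain, E4.ofTimeSpace_apply_zero, CollarEmbedsMGHD.radius_ofTimeSpace_spatial]
  exact ⟨hf, hr⟩

end Points

/-! ## The covering case analysis (Disproof §F re-derived) -/

section Covering

variable [Kerr.Facts] {M a r₁ τ₀ : ℝ}

/-- **`HasExhaustiveCharts` (ii) in the Kerr chart.** For `τ₁ > τ₀`, a point `x ∈ O_K` that is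
neither in the flat chart's image of `{x⁰ > τ₁}` nor in the hole chart's image of the growing near zone
`{s > τ₁, r ≤ R(s)}` lies in the causal past of the certified slab at `τ₁` (hole truncated slab
`{s = τ₁, r ≤ R(τ₁)}` or flat slab `{x⁰ = τ₁}`), via the helix to the appropriate target time.
Case analysis: `s := x⁰ − c₀`, `f := s − T(r)`; (A) `s ≤ τ₁`: hole slab if `r ≤ R(τ₁)`, flat slab
otherwise; (B) `s > τ₁`: then `r > R(s) ≥ R(τ₁) > √τ₁ ≥ √f`, so the flat non-membership forces
`f ≤ τ₁` and the flat slab works. [folklore] -/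
theorem covering_certified (ha : |a| < M) (hM : 0 ≤ M)
    (hτ : Kerr.rPlus M a ≤ Real.sqrt τ₀) (h : r₁ ≤ Kerr.rPlus M a) (h0 : 0 < Kerr.rPlus M a)
    {τ₁ : ℝ} (hτ₁ : τ₀ < τ₁) {x : Kerr.region a r₁}
    (hxr : Kerr.rPlus M a < Kerr.radius a (x : E4))
    (htarget : ∀ t : ℝ, (x : E4) 0 ≤ t → ∃ x' : Kerr.region a r₁, (x' : E4) 0 = t ∧
      Kerr.radius a (x' : E4) = Kerr.radius a (x : E4) ∧
      x' ∈ (Kerr.smoothMetric M a r₁).causalFuture ((Kerr.timeOrientation M a r₁ hM).ofLE le_top) {x})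
    (hnh : x ∉ holeChart M a r₁ τ₀ h '' {p : Kerr.exterior M a | τ₁ < (p : E4) 0 ∧
      Kerr.radius a (p : E4) ≤ nearR ((p : E4) 0)})
    (hnf : x ∉ flatChart M a r₁ τ₀ hτ h h0 '' (Minkowski.backgroundOn (flatDomain a τ₀)).lateRegion τ₁) :
    x ∈ (Kerr.smoothMetric M a r₁).causalPast ((Kerr.timeOrientation M a r₁ hM).ofLE le_top)
      (flatChart M a r₁ τ₀ hτ h h0 '' (Minkowski.backgroundOn (flatDomain a τ₀)).timeSlab τ₁ ∪
        holeChart M a r₁ τ₀ h '' (Kerr.background M a).truncTimeSlab (nearR τ₁) τ₁) := by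
  set r := Kerr.radius a (x : E4) with hrdef
  set c₀ : ℝ := M + 3 with hc₀
  set s : ℝ := (x : E4) 0 - c₀ with hsdef
  set f : ℝ := s - bentHeight M a r with hfdef
  have hT0 : 0 ≤ bentHeight M a r := CollarCauchy.bentHeight_nonneg ha r
  have hτ₀1 : τ₀ ≤ τ₁ := hτ₁.le
  -- (N1) not hole-certified-late
  have hN1 : ¬ (τ₁ < s ∧ r ≤ nearR s) := by
    rintro ⟨hs1, hrs⟩
    apply hnh
    have hs0 : τ₀ ≤ s := by linarith
    have ht : (x : E4) 0 = holeTime M a τ₀ c₀ s r := by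
      rw [holeTime_late_near hs0 (by linarith [nearR_pos s])]
      simp [hsdef]
    refine ⟨⟨E4.ofTimeSpace s (E4.spatial (x : E4)), ofTimeSpace_spatial_mem_exterior h0 hxr s⟩, ?_,
      eq_holeChart_ofTimeSpace h h0 hxr ht⟩
    change τ₁ < (E4.ofTimeSpace s (E4.spatial (x : E4))) 0 ∧
      Kerr.radius a (E4.ofTimeSpace s (E4.spatial (x : E4))) ≤ nearR ((E4.ofTimeSpace s (E4.spatial (x : E4))) 0)
    rw [E4.ofTimeSpace_apply_zero, CollarEmbedsMGHD.radius_ofTimeSpace_spatial]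
    exact ⟨hs1, hrs⟩
  -- (N2) not flat-late
  have hN2 : ¬ (τ₁ < f ∧ Real.sqrt f < r) := by
    rintro ⟨hf1, hfr⟩
    apply hnf
    have hfD : E4.ofTimeSpace f (E4.spatial (x : E4)) ∈ flatDomain a τ₀ :=
      ofTimeSpace_spatial_mem_flatDomain (by linarith) hfr
    have ht : (x : E4) 0 = f + (M + 3) + bentHeight M a (Kerr.radius a (x : E4)) := by
      simp only [hfdef, hsdef, hc₀, hrdef]; ring
    refine ⟨⟨E4.ofTimeSpace f (E4.spatial (x : E4)), hfD⟩, ?_, eq_flatChart_ofTimeSpace hτ h h0 hfD ht⟩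
    change τ₁ < (E4.ofTimeSpace f (E4.spatial (x : E4))) 0
    rw [E4.ofTimeSpace_apply_zero]; exact hf1
  -- the two kinds of target
  have hole_target : s ≤ τ₁ → r ≤ nearR τ₁ → x ∈ (Kerr.smoothMetric M a r₁).causalPast
      ((Kerr.timeOrientation M a r₁ hM).ofLE le_top)
      (flatChart M a r₁ τ₀ hτ h h0 '' (Minkowski.backgroundOn (flatDomain a τ₀)).timeSlab τ₁ ∪
        holeChart M a r₁ τ₀ h '' (Kerr.background M a).truncTimeSlab (nearR τ₁) τ₁) := by
    intro hs1 hr1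
    obtain ⟨x', hx'0, hx'r, hx'J⟩ := htarget (τ₁ + c₀) (by linarith)
    refine mem_causalPast_of_mem_causalFuture_singleton hx'J (Or.inr ?_)
    have hx'R : Kerr.rPlus M a < Kerr.radius a (x' : E4) := by rw [hx'r]; exact hxr
    have ht : (x' : E4) 0 = holeTime M a τ₀ c₀ τ₁ (Kerr.radius a (x' : E4)) := by
      rw [hx'0, holeTime_late_near hτ₀1 (by rw [hx'r]; linarith [nearR_pos τ₁])]
    refine ⟨⟨E4.ofTimeSpace τ₁ (E4.spatial (x' : E4)), ofTimeSpace_spatial_mem_exterior h0 hx'R τ₁⟩, ?_,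
      eq_holeChart_ofTimeSpace h h0 hx'R ht⟩
    change (E4.ofTimeSpace τ₁ (E4.spatial (x' : E4))) 0 = τ₁ ∧
      Kerr.radius a (E4.ofTimeSpace τ₁ (E4.spatial (x' : E4))) ≤ nearR τ₁
    rw [E4.ofTimeSpace_apply_zero, CollarEmbedsMGHD.radius_ofTimeSpace_spatial, hx'r]
    exact ⟨rfl, hr1⟩
  have flat_target : f ≤ τ₁ → Real.sqrt τ₁ < r → x ∈ (Kerr.smoothMetric M a r₁).causalPast
      ((Kerr.timeOrientation M a r₁ hM).ofLE le_top)
      (flatChart M a r₁ τ₀ hτ h h0 '' (Minkowski.backgroundOn (flatDomain a τ₀)).timeSlab τ₁ ∪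
        holeChart M a r₁ τ₀ h '' (Kerr.background M a).truncTimeSlab (nearR τ₁) τ₁) := by
    intro hf1 hr1
    obtain ⟨x', hx'0, hx'r, hx'J⟩ := htarget (τ₁ + c₀ + bentHeight M a r) (by
      simp only [hfdef, hsdef] at hf1 ⊢; linarith)
    refine mem_causalPast_of_mem_causalFuture_singleton hx'J (Or.inl ?_)
    have hfD : E4.ofTimeSpace τ₁ (E4.spatial (x' : E4)) ∈ flatDomain a τ₀ :=
      ofTimeSpace_spatial_mem_flatDomain hτ₁ (by rw [hx'r]; exact hr1)
    have ht : (x' : E4) 0 = τ₁ + (M + 3) + bentHeight M a (Kerr.radius a (x' : E4)) := by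
      rw [hx'0, hx'r]
    refine ⟨⟨E4.ofTimeSpace τ₁ (E4.spatial (x' : E4)), hfD⟩, ?_, eq_flatChart_ofTimeSpace hτ h h0 hfD ht⟩
    change (E4.ofTimeSpace τ₁ (E4.spatial (x' : E4))) 0 = τ₁
    rw [E4.ofTimeSpace_apply_zero]
  have hsqrt_lt : Real.sqrt τ₁ < nearR τ₁ := sqrt_lt_nearR τ₁
  by_cases hs1 : s ≤ τ₁
  · by_cases hr1 : r ≤ nearR τ₁
    · exact hole_target hs1 hr1
    · have hr1 : nearR τ₁ < r := lt_of_not_ge hr1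
      have hf1 : f ≤ τ₁ := by simp only [hfdef]; linarith
      exact flat_target hf1 (hsqrt_lt.trans hr1)
  · have hs1 : τ₁ < s := lt_of_not_ge hs1
    have hrs : nearR s < r := by
      by_contra hh
      exact hN1 ⟨hs1, not_lt.1 hh⟩
    have hR1 : nearR τ₁ ≤ nearR s := nearR_mono hs1.le
    have hfs : f ≤ s := by simp only [hfdef]; linarith
    have hf1 : f ≤ τ₁ := by
      by_contra hh
      have hh : τ₁ < f := lt_of_not_ge hh
      have hsf : Real.sqrt f ≤ Real.sqrt s := Real.sqrt_le_sqrt hfs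
      have : Real.sqrt f < r := lt_of_le_of_lt hsf ((sqrt_lt_nearR s).trans hrs)
      exact hN2 ⟨hh, this⟩
    exact flat_target hf1 (lt_of_lt_of_le hsqrt_lt (hR1.trans hrs.le))

/-- **The covering clause at `τ₀`** (`diff_subset_causalPast`): a point of `O_K` not in the late
image of the hole chart (the flat late image is not even needed) lies in the causal past of the hole
chart's image of the full slab `{s = τ₀}`: `x⁰ ≤ F(τ₀, r)` by surjectivity of `F(·, r)` on
`[τ₀, ∞)`, then the helix to time `F(τ₀, r)`. [folklore] -/
theorem covering_initial (ha : |a| < M) (hM : 0 ≤ M) (hτ₀ : 2 ≤ τ₀)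
    (h : r₁ ≤ Kerr.rPlus M a) (h0 : 0 < Kerr.rPlus M a) {x : Kerr.region a r₁}
    (hxr : Kerr.rPlus M a < Kerr.radius a (x : E4))
    (htarget : ∀ t : ℝ, (x : E4) 0 ≤ t → ∃ x' : Kerr.region a r₁, (x' : E4) 0 = t ∧
      Kerr.radius a (x' : E4) = Kerr.radius a (x : E4) ∧
      x' ∈ (Kerr.smoothMetric M a r₁).causalFuture ((Kerr.timeOrientation M a r₁ hM).ofLE le_top) {x})
    (hnh : x ∉ holeChart M a r₁ τ₀ h '' (Kerr.background M a).lateRegion τ₀) :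
    x ∈ (Kerr.smoothMetric M a r₁).causalPast ((Kerr.timeOrientation M a r₁ hM).ofLE le_top)
      (holeChart M a r₁ τ₀ h '' (Kerr.background M a).timeSlab τ₀) := by
  set r := Kerr.radius a (x : E4) with hrdef
  set c₀ : ℝ := M + 3 with hc₀
  have hc0 : 0 ≤ c₀ := by have : 0 ≤ M := hM; simp only [hc₀]; linarith
  -- `x⁰ ≤ F(τ₀, r)`
  have hle : (x : E4) 0 ≤ holeTime M a τ₀ c₀ τ₀ r := by
    by_contra hlt
    have hlt : holeTime M a τ₀ c₀ τ₀ r < (x : E4) 0 := lt_of_not_ge hlt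
    obtain ⟨s, hs, hst⟩ := exists_holeTime_eq (τ₀ := τ₀) ha hc0 hlt.le
    have hsne : s ≠ τ₀ := by
      rintro rfl; exact absurd hst (ne_of_lt hlt)
    have hs' : τ₀ < s := lt_of_le_of_ne hs (Ne.symm hsne)
    apply hnh
    refine ⟨⟨E4.ofTimeSpace s (E4.spatial (x : E4)), ofTimeSpace_spatial_mem_exterior h0 hxr s⟩, ?_,
      eq_holeChart_ofTimeSpace h h0 hxr hst.symm⟩
    change τ₀ < (E4.ofTimeSpace s (E4.spatial (x : E4))) 0
    rw [E4.ofTimeSpace_apply_zero]; exact hs'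
  obtain ⟨x', hx'0, hx'r, hx'J⟩ := htarget _ hle
  refine mem_causalPast_of_mem_causalFuture_singleton hx'J ?_
  have hx'R : Kerr.rPlus M a < Kerr.radius a (x' : E4) := by rw [hx'r]; exact hxr
  have ht : (x' : E4) 0 = holeTime M a τ₀ c₀ τ₀ (Kerr.radius a (x' : E4)) := by rw [hx'0, hx'r]
  refine ⟨⟨E4.ofTimeSpace τ₀ (E4.spatial (x' : E4)), ofTimeSpace_spatial_mem_exterior h0 hx'R τ₀⟩, ?_,
    eq_holeChart_ofTimeSpace h h0 hx'R ht⟩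
  change (E4.ofTimeSpace τ₀ (E4.spatial (x' : E4))) 0 = τ₀
  rw [E4.ofTimeSpace_apply_zero]

/-- **`O_K ⊆ I⁻(late hole image)`**: from `x ∈ O_K` the helix reaches, strictly later, a point of the
hole chart's late image (any time `t > max(x⁰, F(τ₀, r))` is `F(s, r)` with `s > τ₀`). [folklore] -/
theorem mem_chronologicalPast_holeLate (ha : |a| < M) (hM : 0 ≤ M) (hτ₀ : 2 ≤ τ₀)
    (h : r₁ ≤ Kerr.rPlus M a) (h0 : 0 < Kerr.rPlus M a) {x : Kerr.region a r₁}
    (hxr : Kerr.rPlus M a < Kerr.radius a (x : E4))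
    (hstrict : ∀ t : ℝ, (x : E4) 0 < t → ∃ x' : Kerr.region a r₁, (x' : E4) 0 = t ∧
      Kerr.radius a (x' : E4) = Kerr.radius a (x : E4) ∧
      x' ∈ (Kerr.smoothMetric M a r₁).chronologicalFuture ((Kerr.timeOrientation M a r₁ hM).ofLE le_top) {x}) :
    x ∈ (Kerr.smoothMetric M a r₁).chronologicalPast ((Kerr.timeOrientation M a r₁ hM).ofLE le_top)
      (holeChart M a r₁ τ₀ h '' (Kerr.background M a).lateRegion τ₀) := by
  set r := Kerr.radius a (x : E4) with hrdef
  set c₀ : ℝ := M + 3 with hc₀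
  have hc0 : 0 ≤ c₀ := by have : 0 ≤ M := hM; simp only [hc₀]; linarith
  set t : ℝ := max ((x : E4) 0) (holeTime M a τ₀ c₀ τ₀ r) + 1 with htdef
  have ht1 : (x : E4) 0 < t := by have := le_max_left ((x : E4) 0) (holeTime M a τ₀ c₀ τ₀ r); linarith
  have ht2 : holeTime M a τ₀ c₀ τ₀ r < t := by
    have := le_max_right ((x : E4) 0) (holeTime M a τ₀ c₀ τ₀ r); linarith
  obtain ⟨x', hx'0, hx'r, hx'I⟩ := hstrict t ht1
  obtain ⟨s, hs, hst⟩ := exists_holeTime_eq (τ₀ := τ₀) ha hc0 ht2.le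
  have hsne : s ≠ τ₀ := by rintro rfl; exact absurd hst (ne_of_lt ht2)
  have hs' : τ₀ < s := lt_of_le_of_ne hs (Ne.symm hsne)
  refine mem_chronologicalPast_of_mem_chronologicalFuture_singleton hx'I ?_
  have hx'R : Kerr.rPlus M a < Kerr.radius a (x' : E4) := by rw [hx'r]; exact hxr
  have ht' : (x' : E4) 0 = holeTime M a τ₀ c₀ s (Kerr.radius a (x' : E4)) := by rw [hx'0, hx'r, hst]
  refine ⟨⟨E4.ofTimeSpace s (E4.spatial (x' : E4)), ofTimeSpace_spatial_mem_exterior h0 hx'R s⟩, ?_,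
    eq_holeChart_ofTimeSpace h h0 hx'R ht'⟩
  change τ₀ < (E4.ofTimeSpace s (E4.spatial (x' : E4))) 0
  rw [E4.ofTimeSpace_apply_zero]; exact hs'

end Covering


/-- **Registered helper stub** (S6a part E): the point `(t, x⃗)` lies in the Kerr exterior when
`r(x) > r₊ > 0`. [folklore] -/
theorem _root_.Summit.FinalStateConjecture.FinalStateConjecture.Theorems.SwallowTheDatum.KerrShieldedSettles.stub_kerrExteriorDecompositionCovering :
    ∀ {M a : ℝ}, 0 < Kerr.rPlus M a → ∀ {x : E4}, Kerr.rPlus M a < Kerr.radius a x → ∀ (t : ℝ),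
      E4.ofTimeSpace t (E4.spatial x) ∈ Kerr.exterior M a :=
  fun h0 _ hx t ↦ ofTimeSpace_spatial_mem_exterior h0 hx t

end ExteriorDecomposition

end Summit.FinalStateConjecture.FinalStateConjecture.Theorems.SwallowTheDatum.KerrShieldedSettles

end
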